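import Summits.AtomisticToContinuum.HydrodynamicLimit.Theses.JParityClosure
import Summits.AtomisticToContinuum.HydrodynamicLimit.Theorems.JParityClosureRateFloorRung0

/-!
# Line-in-waiting `anchored-window-transport` for crux `RateFloor` (stmt-AtomisticToContinuum-13080, route JParityClosure)
# — CHECKED SKELETON FOR THE ANCHORED RESTATEMENT, not for the filed text

Strategist workfile (planner-cstrat-stmt-AtomisticToContinuum-13080-p1-0, 2026-08-17; STRATEGY-CENSUS.md §8, crux idea
`anchored-window-transport`).  The FILED crux `Theses.JParityClosure.RateFloor` is unguarded (`∀ τ`, no Euler solution, no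
LLN): census §3 shows every entropy-transport method is capped at "`g₀` after `δ`" for it (lane witness at any positive
specific relative entropy; hidden entropy `klDiv/(N+1) → Δs > 0` past the first shock), so nothing here concludes
`RateFloor` by name and this file is deliberately NOT registered with `ledger skeleton check`.

What it IS: the kernel-checked composition of the line that closes the ANCHORED restatement `RateFloorAnchored` (the filed
text moved into the glue's frame `τ < T` and made conditional on the conjunct's field LLN on `[0, τ]`, consumed INDUCTIVELY by
the closure step) from three stubs, each accessible to ONE-TIME statics under the anchor:

* S1 `stub_anchorFromLLN : AnchorFromLLN` — bookkeeping bridge: field LLN on `[0,τ]` ⇒ specific relative entropy `o(N)` to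
  the Euler-driven local Gibbs law (exact finite-`N` identity — Liouville invariance of `∫ f log f` + log-linearity of
  hard-sphere local Gibbs densities in the one-body empirical fields — read at the Euler-driven reference, where it is the
  pairing of the MEAN field error with the entropy variables `Dh_σ(U(s))` plus the classical entropy balance
  `integral_entropy_eq`; bounded convergence, the energy being bounded pathwise by its conserved total; in-hub:
  `Theses.JaynesSqueeze.BlockGibbsToRelEntropy` plan (d), `squeezeToBlockGibbs_proof`, `hardSphereLDA_proof`).  [M–L]
* S2 `stub_anchoredPlateau : AnchoredPlateau` — THE r-STEP, now static: under the entropic anchor the crux's time-integrated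
  r-mollified ideal functional `∫₀^τ∫ χ B^Ξ_r(z_s)` is at most `2·Pr + η` w.h.p., `Pr = ∫₀^τ∫ χ ρ² Θ^Ξ[M_{u,θ}]` the
  Euler–Maxwellian (r-free) prediction: one-time UPPER tails of the U-statistic `∫χ B_r` under SMOOTH Maxwellian local Gibbs
  laws (rate `N`), the expectation-form entropy inequality at each `s`, Fubini + Markov in `s`.  No sub-grid input: the
  reference is smooth at every scale `r`, and a realised sub-`r` segregation costs specific entropy `> 0` — excluded by the
  budget `κ_N → 0`.  [L]
* S3 `stub_anchoredRealisedFloor : AnchoredRealisedFloor` — under the entropic anchor the REALISED would-be functional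
  `S_R = lineSR ε (windowLen A N) τ γ (χ·Ξ)` over windows of `A ≤ A₁` mean free times (exponent pinned to `1/3`) dominates
  `g₄ σ³ Pr − η` w.h.p., `g₄ > 0` universal: `S_R ≥ S^iso` (isolated would-be 2-clusters of the window-start configuration
  DO collide — speed-budget cluster closure, Alexander-type), static LOWER-tail large deviations of `S^iso` at tilt
  `c·(N+1)^{4/3}` under smooth Maxwellian local Gibbs laws (cluster expansion: each missing pair costs `O(1)`; no o(N)-cost
  "monster" can remove more than o(N^{4/3}·Δ) isolated pairs per window), the expectation-form entropy inequality per window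
  and the sum over the `τσ²(N+1)^{1/3}/A` windows, which the budget `κ_N → 0` beats for every FIXED `A`
  (`E[deficit] ≲ τσ³κ_N/(cA) → 0`; census §3 (W2)).  THE HARDEST STUB.  [L–XL]

— through `rateFloorEntropicAnchor_of` (sure inequality `K ≥ S_R` on good orbits = the landed
`RateFloorRung0.lineSR_le_collisionFunctional`, `η ↦ (η/g₄, η/2)`, `δ ↦ (δ/2, δ/2)`, union bound with the Liouville-null
bad set, `g₀ := g₄/2`; NO burst term — bursts only ADD collisions and the line never charges them) and
`rateFloorAnchored_of_entropic`.  Also checked: `rateFloorAnchored_of_rateFloor` (the restatement is a WEAKENING of the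
filed crux).  `lean check`: rc 0, sorries = the three `stub_*` only.
-/

noncomputable section

open scoped BigOperators Topology ENNReal NNReal InnerProductSpace RealInnerProductSpace Classical
open MeasureTheory Set Filter Function
open Literature.Analysis.FluidPDE Literature.MathematicalPhysics.KineticTheory
open Summit.AtomisticToContinuum.HydrodynamicLimit.Theorems
open Summit.AtomisticToContinuum.HydrodynamicLimit.Theorems.RateFloorLine
open Summit.AtomisticToContinuum.HydrodynamicLimit.Theorems.RateFloorRung0

namespace Summit.AtomisticToContinuum.HydrodynamicLimit.Cruxes.RateFloor.AnchoredWindowTransport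

/-- **RateFloorAnchored** — the filed `RateFloor` moved into the glue's frame (classical hs-Euler solution on
`[0,T)`, local-Gibbs flows with the `t = 0` LLN, horizon `0 < τ < T`) and made CONDITIONAL on the hydrodynamic anchor
`∀ s ∈ [0,τ], TendstoHydroFieldsAt … s`.  Everything after `∀ χ` is the filed text verbatim. -/
def RateFloorAnchored : Prop :=
  ∃ g₀ : ℝ, 0 < g₀ ∧ ∀ (a₀ θ₀ : Literature.MathematicalPhysics.KineticTheory.T3 → ℝ) (u₀ : Literature.MathematicalPhysics.KineticTheory.T3 → Literature.MathematicalPhysics.KineticTheory.V3), Continuous a₀ → Continuous θ₀ → Continuous u₀ → (∀ x, 0 < a₀ x) → (∀ x, 0 < θ₀ x) → ∃ σ₀ : ℝ, 0 < σ₀ ∧ ∀ σ : ℝ, 0 < σ → σ < σ₀ → ∀ (T : ℝ) (ρ θ : ℝ → Literature.MathematicalPhysics.KineticTheory.T3 → ℝ) (u : ℝ → Literature.MathematicalPhysics.KineticTheory.T3 → Literature.MathematicalPhysics.KineticTheory.V3), Literature.MathematicalPhysics.KineticTheory.IsHardSphereEulerSolution σ T ρ u θ → ∀ Φ : (N : ℕ)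 → Literature.Analysis.FluidPDE.HardSphereFlow (Literature.Analysis.FluidPDE.Torus.geometry (Fin 3)) (Literature.MathematicalPhysics.KineticTheory.hsDiameter σ N) (N + 1), Literature.MathematicalPhysics.KineticTheory.TendstoHydroFieldsAt (fun N => Literature.MathematicalPhysics.KineticTheory.localGibbsLaw σ a₀ u₀ θ₀ N (Φ N)) Φ ρ u θ 0 → ∀ τ : ℝ, 0 < τ → τ < T → (∀ s ∈ Set.Icc 0 τ, Literature.MathematicalPhysics.KineticTheory.TendstoHydroFieldsAt (fun N => Literature.MathematicalPhysics.KineticTheory.localGibbsLaw σ a₀ u₀ θ₀ N (Φ N)) Φ ρ u θ s) → ∀ χ : ℝ × UnitAddTorus (Fin 3) → ℝ, Continuous χ → (∀ p, 0 ≤ χ p) → ∀ Ξ : EuclideanSpace ℝ (Fin 3) × EuclideanSpace ℝ (Fin 3) × EuclideanSpace ℝ (Fin 3) → ℝ, Continuous Ξ → (∀ q, 0 ≤ Ξ q) → (∃ C : ℝ, ∀ q, Ξ q ≤ C) → ∀ η δ : ℝ, 0 < η → 0 < δ → ∃ r₀ : ℝ, 0 < r₀ ∧ ∀ r : ℝ,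 0 < r → r < r₀ → ∃ N₀ : ℕ, ∀ N : ℕ, N₀ ≤ N → let ε := Literature.MathematicalPhysics.KineticTheory.hsDiameter σ N; let G := Literature.Analysis.FluidPDE.Torus.geometry (Fin 3); let γ := fun z (s : ℝ) => (Φ N).flow s z; let bx : UnitAddTorus (Fin 3) → UnitAddTorus (Fin 3) → ℝ := fun x y => 3 / (Real.pi * r ^ 3) * max (1 - Literature.Analysis.FluidPDE.Torus.euclidDist x y / r) 0; let Θ := fun (Ξ : EuclideanSpace ℝ (Fin 3) × EuclideanSpace ℝ (Fin 3) × EuclideanSpace ℝ (Fin 3) → ℝ) (v w : EuclideanSpace ℝ (Fin 3)) => ∫ ω : Metric.sphere (0 : EuclideanSpace ℝ (Fin 3)) 1, Ξ ((ω : EuclideanSpace ℝ (Fin 3)), v, w) * Literature.MathematicalPhysics.KineticTheory.hardSphereKernel (w, v) ω ∂Literature.MathematicalPhysics.KineticTheory.sphereMeasure; let B := fun Ξ z s (x₀ : UnitAddTorus (Fin 3)) => ∫ p, bx p.1.1 x₀ * bx p.2.1 x₀ * Θ Ξ p.1.2 p.2.2 ∂((Literature.Analysis.FluidPDE.empiricalMeasure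 (γ z s)).prod (Literature.Analysis.FluidPDE.empiricalMeasure (γ z s))); let pv := fun z s (i j : Fin (N + 1)) => Literature.Analysis.FluidPDE.reflectVel (G.sepVec (γ z s i).1 (γ z s j).1) ((γ z s i).2, (γ z s j).2); let Kc := fun (Fn : Literature.Analysis.FluidPDE.Config (N + 1) (Fin 3) Literature.MathematicalPhysics.KineticTheory.T3 → ℝ → Fin (N + 1) → Fin (N + 1) → ℝ) z => ε / (N + 1 : ℝ) * ∑ᶠ (s : ℝ) (_ : s ∈ Literature.Analysis.FluidPDE.collisionTimes G ε (γ z) ∩ Set.Icc 0 τ), ∑ i : Fin (N + 1), ∑ j : Fin (N + 1), (if i ≠ j ∧ ‖G.sepVec (γ z s i).1 (γ z s j).1‖ = ε then Fn z s i j else 0); Literature.MathematicalPhysics.KineticTheory.localGibbsLaw σ a₀ u₀ θ₀ N (Φ N) {z | Kc (fun z s i j => χ (s, (γ z s i).1) * Ξ (ε⁻¹ • G.sepVec (γ z s i).1 (γ z s j).1, (pv z s i j).1, (pv z s i j).2)) z < g₀ * σ ^ 3 * (∫ s in Set.Icc (0 : ℝ) τ, ∫ x : UnitAddTorus (Fin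 3), χ (s, x) * B Ξ z s x) - η} ≤ ENNReal.ofReal δ

/-- **RateFloorEntropicAnchor** — same frame, hypothesis = the ENTROPIC anchor: for a continuous positive activity
family `a s`, `klDiv(law_s ‖ localGibbsLaw σ (a s) (u s) (θ s)) ≤ κ(N+1)` for all `s ≤ τ`, eventually in `N`, for
every `κ > 0` (Yau's form at the Euler-driven reference, cf. `Theses.JaynesSqueeze.RelEntropyVanishing`). -/
def RateFloorEntropicAnchor : Prop :=
  ∃ g₀ : ℝ, 0 < g₀ ∧ ∀ (a₀ θ₀ : Literature.MathematicalPhysics.KineticTheory.T3 → ℝ) (u₀ : Literature.MathematicalPhysics.KineticTheory.T3 → Literature.MathematicalPhysics.KineticTheory.V3), Continuous a₀ → Continuous θ₀ → Continuous u₀ → (∀ x, 0 < a₀ x) → (∀ x, 0 < θ₀ x) → ∃ σ₀ : ℝ, 0 < σ₀ ∧ ∀ σ : ℝ, 0 < σ → σ < σ₀ → ∀ (T : ℝ) (ρ θ : ℝ → Literature.MathematicalPhysics.KineticTheory.T3 → ℝ) (u : ℝ → Literature.MathematicalPhysics.KineticTheory.T3 → Literature.MathematicalPhysics.KineticTheory.V3),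 Literature.MathematicalPhysics.KineticTheory.IsHardSphereEulerSolution σ T ρ u θ → ∀ Φ : (N : ℕ) → Literature.Analysis.FluidPDE.HardSphereFlow (Literature.Analysis.FluidPDE.Torus.geometry (Fin 3)) (Literature.MathematicalPhysics.KineticTheory.hsDiameter σ N) (N + 1), ∀ τ : ℝ, 0 < τ → τ < T → ∀ a : ℝ → Literature.MathematicalPhysics.KineticTheory.T3 → ℝ, (∀ s, Continuous (a s)) → (∀ s x, 0 < a s x) → (∀ κ : ℝ, 0 < κ → ∃ N₁ : ℕ, ∀ N : ℕ, N₁ ≤ N → ∀ s ∈ Set.Icc 0 τ, InformationTheory.klDiv ((Φ N).lawAt (Literature.MathematicalPhysics.KineticTheory.localGibbsLaw σ a₀ u₀ θ₀ N (Φ N)) s) (Literature.MathematicalPhysics.KineticTheory.localGibbsLaw σ (a s) (u s) (θ s) N (Φ N)) ≤ ENNReal.ofReal (κ * ((N : ℝ) + 1))) → ∀ χ : ℝ × UnitAddTorus (Fin 3) → ℝ, Continuous χ → (∀ p, 0 ≤ χ p) → ∀ Ξ : EuclideanSpace ℝ (Fin 3) × EuclideanSpace ℝ (Fin 3) × EuclideanSpace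 ℝ (Fin 3) → ℝ, Continuous Ξ → (∀ q, 0 ≤ Ξ q) → (∃ C : ℝ, ∀ q, Ξ q ≤ C) → ∀ η δ : ℝ, 0 < η → 0 < δ → ∃ r₀ : ℝ, 0 < r₀ ∧ ∀ r : ℝ, 0 < r → r < r₀ → ∃ N₀ : ℕ, ∀ N : ℕ, N₀ ≤ N → let ε := Literature.MathematicalPhysics.KineticTheory.hsDiameter σ N; let G := Literature.Analysis.FluidPDE.Torus.geometry (Fin 3); let γ := fun z (s : ℝ) => (Φ N).flow s z; let bx : UnitAddTorus (Fin 3) → UnitAddTorus (Fin 3) → ℝ := fun x y => 3 / (Real.pi * r ^ 3) * max (1 - Literature.Analysis.FluidPDE.Torus.euclidDist x y / r) 0; let Θ := fun (Ξ : EuclideanSpace ℝ (Fin 3) × EuclideanSpace ℝ (Fin 3) × EuclideanSpace ℝ (Fin 3) → ℝ) (v w : EuclideanSpace ℝ (Fin 3)) => ∫ ω : Metric.sphere (0 : EuclideanSpace ℝ (Fin 3)) 1, Ξ ((ω : EuclideanSpace ℝ (Fin 3)), v, w) * Literature.MathematicalPhysics.KineticTheory.hardSphereKernel (w, v) ω ∂Literature.MathematicalPhysics.KineticTheory.sphereMeasure;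 let B := fun Ξ z s (x₀ : UnitAddTorus (Fin 3)) => ∫ p, bx p.1.1 x₀ * bx p.2.1 x₀ * Θ Ξ p.1.2 p.2.2 ∂((Literature.Analysis.FluidPDE.empiricalMeasure (γ z s)).prod (Literature.Analysis.FluidPDE.empiricalMeasure (γ z s))); let pv := fun z s (i j : Fin (N + 1)) => Literature.Analysis.FluidPDE.reflectVel (G.sepVec (γ z s i).1 (γ z s j).1) ((γ z s i).2, (γ z s j).2); let Kc := fun (Fn : Literature.Analysis.FluidPDE.Config (N + 1) (Fin 3) Literature.MathematicalPhysics.KineticTheory.T3 → ℝ → Fin (N + 1) → Fin (N + 1) → ℝ) z => ε / (N + 1 : ℝ) * ∑ᶠ (s : ℝ) (_ : s ∈ Literature.Analysis.FluidPDE.collisionTimes G ε (γ z) ∩ Set.Icc 0 τ), ∑ i : Fin (N + 1), ∑ j : Fin (N + 1), (if i ≠ j ∧ ‖G.sepVec (γ z s i).1 (γ z s j).1‖ = ε then Fn z s i j else 0); Literature.MathematicalPhysics.KineticTheory.localGibbsLaw σ a₀ u₀ θ₀ N (Φ N) {z | Kc (fun z s i j => χ (s, (γ z s i).1) * Ξ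 (ε⁻¹ • G.sepVec (γ z s i).1 (γ z s j).1, (pv z s i j).1, (pv z s i j).2)) z < g₀ * σ ^ 3 * (∫ s in Set.Icc (0 : ℝ) τ, ∫ x : UnitAddTorus (Fin 3), χ (s, x) * B Ξ z s x) - η} ≤ ENNReal.ofReal δ

/-- **AnchorFromLLN** (stub S1's statement) — field LLN on `[0,τ]` ⇒ entropic anchor w.r.t. the Euler-driven local
Gibbs law for SOME continuous positive activity family. -/
def AnchorFromLLN : Prop :=
  ∀ (a₀ θ₀ : Literature.MathematicalPhysics.KineticTheory.T3 → ℝ) (u₀ : Literature.MathematicalPhysics.KineticTheory.T3 → Literature.MathematicalPhysics.KineticTheory.V3), Continuous a₀ → Continuous θ₀ → Continuous u₀ → (∀ x, 0 < a₀ x) → (∀ x, 0 < θ₀ x) → ∃ σ₀ : ℝ, 0 < σ₀ ∧ ∀ σ : ℝ, 0 < σ → σ < σ₀ → ∀ (T : ℝ) (ρ θ : ℝ → Literature.MathematicalPhysics.KineticTheory.T3 → ℝ) (u : ℝ → Literature.MathematicalPhysics.KineticTheory.T3 → Literature.MathematicalPhysics.KineticTheory.V3), Literature.MathematicalPhysics.KineticTheory.IsHardSphereEulerSolution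 σ T ρ u θ → ∀ Φ : (N : ℕ) → Literature.Analysis.FluidPDE.HardSphereFlow (Literature.Analysis.FluidPDE.Torus.geometry (Fin 3)) (Literature.MathematicalPhysics.KineticTheory.hsDiameter σ N) (N + 1), Literature.MathematicalPhysics.KineticTheory.TendstoHydroFieldsAt (fun N => Literature.MathematicalPhysics.KineticTheory.localGibbsLaw σ a₀ u₀ θ₀ N (Φ N)) Φ ρ u θ 0 → ∀ τ : ℝ, 0 < τ → τ < T → (∀ s ∈ Set.Icc 0 τ, Literature.MathematicalPhysics.KineticTheory.TendstoHydroFieldsAt (fun N => Literature.MathematicalPhysics.KineticTheory.localGibbsLaw σ a₀ u₀ θ₀ N (Φ N)) Φ ρ u θ s) → ∃ a : ℝ → Literature.MathematicalPhysics.KineticTheory.T3 → ℝ, (∀ s, Continuous (a s)) ∧ (∀ s x, 0 < a s x) ∧ (∀ κ : ℝ, 0 < κ → ∃ N₁ : ℕ, ∀ N : ℕ, N₁ ≤ N → ∀ s ∈ Set.Icc 0 τ, InformationTheory.klDiv ((Φ N).lawAt (Literature.MathematicalPhysics.KineticTheory.localGibbsLaw σ a₀ u₀ θ₀ N (Φ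 N)) s) (Literature.MathematicalPhysics.KineticTheory.localGibbsLaw σ (a s) (u s) (θ s) N (Φ N)) ≤ ENNReal.ofReal (κ * ((N : ℝ) + 1)))

/-- **AnchoredPlateau** (stub S2's statement; the r-step) — in the frame and under the entropic anchor: for all marks
and `η, δ > 0` there is `r₀ > 0` such that for `r < r₀`, eventually in `N`,
`P(2·Pr + η < ∫₀^τ∫ χ B^Ξ_r(z_s)) ≤ δ`, where `Pr = ∫₀^τ∫ χ(s,x) ρ(s,x)² Θ^Ξ[M_(u(s,x),θ(s,x))] dx ds` is the
Euler–Maxwellian prediction (`Θ^Ξ[M] = ∫∫ Θ^Ξ(v,w) M(v) M(w)`). -/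
def AnchoredPlateau : Prop :=
  ∀ (a₀ θ₀ : Literature.MathematicalPhysics.KineticTheory.T3 → ℝ) (u₀ : Literature.MathematicalPhysics.KineticTheory.T3 → Literature.MathematicalPhysics.KineticTheory.V3), Continuous a₀ → Continuous θ₀ → Continuous u₀ → (∀ x, 0 < a₀ x) → (∀ x, 0 < θ₀ x) → ∃ σ₀ : ℝ, 0 < σ₀ ∧ ∀ σ : ℝ, 0 < σ → σ < σ₀ → ∀ (T : ℝ) (ρ θ : ℝ → Literature.MathematicalPhysics.KineticTheory.T3 → ℝ) (u : ℝ → Literature.MathematicalPhysics.KineticTheory.T3 → Literature.MathematicalPhysics.KineticTheory.V3), Literature.MathematicalPhysics.KineticTheory.IsHardSphereEulerSolution σ T ρ u θ → ∀ Φ : (N : ℕ) → Literature.Analysis.FluidPDE.HardSphereFlow (Literature.Analysis.FluidPDE.Torus.geometry (Fin 3)) (Literature.MathematicalPhysics.KineticTheory.hsDiameter σ N) (N + 1), ∀ τ : ℝ, 0 < τ → τ < T → ∀ a : ℝ → Literature.MathematicalPhysics.KineticTheory.T3 → ℝ, (∀ s, Continuous (a s)) → (∀ s x, 0 < a s x)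 → (∀ κ : ℝ, 0 < κ → ∃ N₁ : ℕ, ∀ N : ℕ, N₁ ≤ N → ∀ s ∈ Set.Icc 0 τ, InformationTheory.klDiv ((Φ N).lawAt (Literature.MathematicalPhysics.KineticTheory.localGibbsLaw σ a₀ u₀ θ₀ N (Φ N)) s) (Literature.MathematicalPhysics.KineticTheory.localGibbsLaw σ (a s) (u s) (θ s) N (Φ N)) ≤ ENNReal.ofReal (κ * ((N : ℝ) + 1))) → ∀ χ : ℝ × UnitAddTorus (Fin 3) → ℝ, Continuous χ → (∀ p, 0 ≤ χ p) → ∀ Ξ : EuclideanSpace ℝ (Fin 3) × EuclideanSpace ℝ (Fin 3) × EuclideanSpace ℝ (Fin 3) → ℝ, Continuous Ξ → (∀ q, 0 ≤ Ξ q) → (∃ C : ℝ, ∀ q, Ξ q ≤ C) → ∀ η δ : ℝ, 0 < η → 0 < δ → ∃ r₀ : ℝ, 0 < r₀ ∧ ∀ r : ℝ, 0 < r → r < r₀ → ∃ N₀ : ℕ, ∀ N : ℕ, N₀ ≤ N → let γ := fun z (s : ℝ) => (Φ N).flow s z; let bx : UnitAddTorus (Fin 3) → UnitAddTorus (Fin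 3) → ℝ := fun x y => 3 / (Real.pi * r ^ 3) * max (1 - Literature.Analysis.FluidPDE.Torus.euclidDist x y / r) 0; let Θ := fun (Ξ : EuclideanSpace ℝ (Fin 3) × EuclideanSpace ℝ (Fin 3) × EuclideanSpace ℝ (Fin 3) → ℝ) (v w : EuclideanSpace ℝ (Fin 3)) => ∫ ω : Metric.sphere (0 : EuclideanSpace ℝ (Fin 3)) 1, Ξ ((ω : EuclideanSpace ℝ (Fin 3)), v, w) * Literature.MathematicalPhysics.KineticTheory.hardSphereKernel (w, v) ω ∂Literature.MathematicalPhysics.KineticTheory.sphereMeasure; let B := fun Ξ z s (x₀ : UnitAddTorus (Fin 3)) => ∫ p, bx p.1.1 x₀ * bx p.2.1 x₀ * Θ Ξ p.1.2 p.2.2 ∂((Literature.Analysis.FluidPDE.empiricalMeasure (γ z s)).prod (Literature.Analysis.FluidPDE.empiricalMeasure (γ z s))); let ΘM := fun (uu : EuclideanSpace ℝ (Fin 3)) (th : ℝ) => ∫ v : EuclideanSpace ℝ (Fin 3), ∫ w : EuclideanSpace ℝ (Fin 3), Θ Ξ v w * Literature.Analysis.FluidPDE.localMaxwellian 1 th uu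 v * Literature.Analysis.FluidPDE.localMaxwellian 1 th uu w; let Pr : ℝ := ∫ s in Set.Icc (0 : ℝ) τ, ∫ x : UnitAddTorus (Fin 3), χ (s, x) * (ρ s x) ^ 2 * ΘM (u s x) (θ s x); Literature.MathematicalPhysics.KineticTheory.localGibbsLaw σ a₀ u₀ θ₀ N (Φ N) {z | 2 * Pr + η < ∫ s in Set.Icc (0 : ℝ) τ, ∫ x : UnitAddTorus (Fin 3), χ (s, x) * B Ξ z s x} ≤ ENNReal.ofReal δ

/-- **AnchoredRealisedFloor** (stub S3's statement; the line's heart) — in the frame and under the entropic anchor: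
`∃ g₄ > 0` (universal) such that for all marks and `η, δ > 0` there is `A₁ > 0` with: for every window parameter
`0 < A ≤ A₁` (windows `windowLen A N = A (N+1)^(-1/3)`), eventually in `N`, `P(S_R < g₄ σ³ Pr − η) ≤ δ`,
`S_R = lineSR ε (windowLen A N) τ γ (χ·Ξ)` the REALISED would-be functional (landed definitions file). -/
def AnchoredRealisedFloor : Prop :=
  ∃ g₄ : ℝ, 0 < g₄ ∧ ∀ (a₀ θ₀ : Literature.MathematicalPhysics.KineticTheory.T3 → ℝ) (u₀ : Literature.MathematicalPhysics.KineticTheory.T3 → Literature.MathematicalPhysics.KineticTheory.V3), Continuous a₀ → Continuous θ₀ → Continuous u₀ → (∀ x, 0 < a₀ x) → (∀ x, 0 < θ₀ x) → ∃ σ₀ : ℝ, 0 < σ₀ ∧ ∀ σ : ℝ, 0 < σ → σ < σ₀ → ∀ (T : ℝ) (ρ θ : ℝ → Literature.MathematicalPhysics.KineticTheory.T3 → ℝ) (u : ℝ → Literature.MathematicalPhysics.KineticTheory.T3 → Literature.MathematicalPhysics.KineticTheory.V3), Literature.MathematicalPhysics.KineticTheory.IsHardSphereEulerSolution σ T ρ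 u θ → ∀ Φ : (N : ℕ) → Literature.Analysis.FluidPDE.HardSphereFlow (Literature.Analysis.FluidPDE.Torus.geometry (Fin 3)) (Literature.MathematicalPhysics.KineticTheory.hsDiameter σ N) (N + 1), ∀ τ : ℝ, 0 < τ → τ < T → ∀ a : ℝ → Literature.MathematicalPhysics.KineticTheory.T3 → ℝ, (∀ s, Continuous (a s)) → (∀ s x, 0 < a s x) → (∀ κ : ℝ, 0 < κ → ∃ N₁ : ℕ, ∀ N : ℕ, N₁ ≤ N → ∀ s ∈ Set.Icc 0 τ, InformationTheory.klDiv ((Φ N).lawAt (Literature.MathematicalPhysics.KineticTheory.localGibbsLaw σ a₀ u₀ θ₀ N (Φ N)) s) (Literature.MathematicalPhysics.KineticTheory.localGibbsLaw σ (a s) (u s) (θ s) N (Φ N)) ≤ ENNReal.ofReal (κ * ((N : ℝ) + 1))) → ∀ χ : ℝ × UnitAddTorus (Fin 3) → ℝ, Continuous χ → (∀ p, 0 ≤ χ p) → ∀ Ξ : EuclideanSpace ℝ (Fin 3) × EuclideanSpace ℝ (Fin 3) × EuclideanSpace ℝ (Fin 3) → ℝ, Continuous Ξ → (∀ q, 0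 ≤ Ξ q) → (∃ C : ℝ, ∀ q, Ξ q ≤ C) → ∀ η δ : ℝ, 0 < η → 0 < δ → ∃ A₁ : ℝ, 0 < A₁ ∧ ∀ A : ℝ, 0 < A → A ≤ A₁ → ∃ N₀ : ℕ, ∀ N : ℕ, N₀ ≤ N → let ε := Literature.MathematicalPhysics.KineticTheory.hsDiameter σ N; let G := Literature.Analysis.FluidPDE.Torus.geometry (Fin 3); let γ := fun z (s : ℝ) => (Φ N).flow s z; let Θ := fun (Ξ : EuclideanSpace ℝ (Fin 3) × EuclideanSpace ℝ (Fin 3) × EuclideanSpace ℝ (Fin 3) → ℝ) (v w : EuclideanSpace ℝ (Fin 3)) => ∫ ω : Metric.sphere (0 : EuclideanSpace ℝ (Fin 3)) 1, Ξ ((ω : EuclideanSpace ℝ (Fin 3)), v, w) * Literature.MathematicalPhysics.KineticTheory.hardSphereKernel (w, v) ω ∂Literature.MathematicalPhysics.KineticTheory.sphereMeasure; let ΘM := fun (uu : EuclideanSpace ℝ (Fin 3)) (th : ℝ) => ∫ v : EuclideanSpace ℝ (Fin 3), ∫ w : EuclideanSpace ℝ (Fin 3), Θ Ξ v w * Literature.Analysis.FluidPDE.localMaxwellian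 1 th uu v * Literature.Analysis.FluidPDE.localMaxwellian 1 th uu w; let Pr : ℝ := ∫ s in Set.Icc (0 : ℝ) τ, ∫ x : UnitAddTorus (Fin 3), χ (s, x) * (ρ s x) ^ 2 * ΘM (u s x) (θ s x); let SR := fun (z : Literature.Analysis.FluidPDE.Config (N + 1) (Fin 3) Literature.MathematicalPhysics.KineticTheory.T3) => Summit.AtomisticToContinuum.HydrodynamicLimit.Theorems.RateFloorLine.lineSR ε (Summit.AtomisticToContinuum.HydrodynamicLimit.Theorems.RateFloorLine.windowLen A N) τ (γ z) (fun u' x y v w => χ (u', x) * Ξ (ε⁻¹ • G.sepVec x y, v, w)); Literature.MathematicalPhysics.KineticTheory.localGibbsLaw σ a₀ u₀ θ₀ N (Φ N) {z | SR z < g₄ * σ ^ 3 * Pr - η} ≤ ENNReal.ofReal δ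

/-! ### The three stubs (sorried: this is a skeleton) -/

/-- S1 — bookkeeping bridge (JaynesSqueeze identity at the Euler-driven reference + `integral_entropy_eq` + bounded
convergence of the energy pairing). -/
theorem stub_anchorFromLLN : AnchorFromLLN := by
  sorry

/-- S2 — anchored plateau for the time-integrated r-mollified ideal functional (the r-step, one-time statics). -/
theorem stub_anchoredPlateau : AnchoredPlateau := by
  sorry

/-- S3 — anchored floor for the realised would-be functional over windows of `A ≤ A₁` mean free times. -/
theorem stub_anchoredRealisedFloor : AnchoredRealisedFloor := by
  sorry

/-! ### Checked compositions -/

/-- The restatement is a WEAKENING of the filed crux. -/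
theorem rateFloorAnchored_of_rateFloor (h : Theses.JParityClosure.RateFloor) : RateFloorAnchored := by
  obtain ⟨g₀, hg₀, H⟩ := h
  refine ⟨g₀, hg₀, fun a₀ θ₀ u₀ ha hθ hu hap hθp => ?_⟩
  obtain ⟨σ₀, hσ₀, H1⟩ := H a₀ θ₀ u₀ ha hθ hu hap hθp
  exact ⟨σ₀, hσ₀, fun σ hσ hσ' T ρ θ u _ Φ _ τ hτ _ _ => H1 σ hσ hσ' Φ τ hτ⟩

/-- Bookkeeping bridge + entropic-anchor floor ⇒ anchored floor. -/
theorem rateFloorAnchored_of_entropic (h1 : AnchorFromLLN) (h2 : RateFloorEntropicAnchor) :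
    RateFloorAnchored := by
  obtain ⟨g₀, hg₀, H⟩ := h2
  refine ⟨g₀, hg₀, fun a₀ θ₀ u₀ ha hθ hu hap hθp => ?_⟩
  obtain ⟨σ₁, hσ₁, H1⟩ := h1 a₀ θ₀ u₀ ha hθ hu hap hθp
  obtain ⟨σ₂, hσ₂, H2⟩ := H a₀ θ₀ u₀ ha hθ hu hap hθp
  refine ⟨min σ₁ σ₂, lt_min hσ₁ hσ₂, fun σ hσ hσ' T ρ θ u hsol Φ h0 τ hτ hτT hanch => ?_⟩
  obtain ⟨a, ha', hapos', hkl⟩ :=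
    H1 σ hσ (lt_of_lt_of_le hσ' (min_le_left _ _)) T ρ θ u hsol Φ h0 τ hτ hτT hanch
  exact H2 σ hσ (lt_of_lt_of_le hσ' (min_le_right _ _)) T ρ θ u hsol Φ τ hτ hτT a ha' hapos' hkl

/-- The arithmetic of the composition (kept separate so that no tactic normalises the crux's large terms):
from `K < g₃ σ³ I − η`, `S_R ≤ K`, the plateau `I ≤ 2 Pr + η/g₄`, the realised floor `S_R ≥ g₄ σ³ Pr − η/2`,
`g₃ = g₄/2` and `σ³ ≤ 1`, a contradiction. [folklore] -/
theorem anchored_deficit_arith {K SR I Pr η g₄ s3 : ℝ} (hη : 0 < η) (hg : 0 < g₄) (hs0 : 0 ≤ s3) (hs1 : s3 ≤ 1)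
    (hz : K < g₄ / 2 * s3 * I - η) (hKR : SR ≤ K) (hP : ¬ (2 * Pr + η / g₄ < I))
    (hF : ¬ (SR < g₄ * s3 * Pr - η / 2)) : False := by
  simp only [not_lt] at hP hF
  have h1 : g₄ / 2 * s3 * I ≤ g₄ / 2 * s3 * (2 * Pr + η / g₄) :=
    mul_le_mul_of_nonneg_left hP (by positivity)
  have h2 : g₄ / 2 * s3 * (2 * Pr + η / g₄) = g₄ * s3 * Pr + s3 * η / 2 := by
    field_simp
  have h3 : s3 * η / 2 ≤ η / 2 := by nlinarith
  linarith

/-- **The entropic-anchor floor from S2 + S3** — sure inequality `K ≥ S_R` on good orbits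
(`RateFloorRung0.lineSR_le_collisionFunctional`), the plateau with `η/g₄`, the realised floor with `η/2`, each at confidence
`δ/2`, union bound with the Liouville-null bad set; `g₀ := g₄/2`, `σ₀ := min (min σa σb) ½`, `r₀` from the plateau,
`A := A₁` from the floor, `N₀ := max`. -/
theorem rateFloorEntropicAnchor_of (hP : AnchoredPlateau) (hR : AnchoredRealisedFloor) : RateFloorEntropicAnchor := by
  obtain ⟨g₄, hg₄, hR⟩ := hR
  refine ⟨g₄ / 2, half_pos hg₄, fun a₀ θ₀ u₀ ha hθ hu hap hθp => ?_⟩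
  obtain ⟨σa, hσa, hP⟩ := hP a₀ θ₀ u₀ ha hθ hu hap hθp
  obtain ⟨σb, hσb, hR⟩ := hR a₀ θ₀ u₀ ha hθ hu hap hθp
  refine ⟨min (min σa σb) 2⁻¹, lt_min (lt_min hσa hσb) (by norm_num), ?_⟩
  intro σ hσ hσlt T ρ θ u hsol Φ τ hτ hτT a hac hapos hkl χ hχc hχ0 Ξ hΞc hΞ0 hΞC η δ hη hδ
  have hσa' : σ < σa := hσlt.trans_le ((min_le_left _ _).trans (min_le_left _ _))
  have hσb' : σ < σb := hσlt.trans_le ((min_le_left _ _).trans (min_le_right _ _))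
  have hσ2 : σ < 2⁻¹ := hσlt.trans_le (min_le_right _ _)
  -- S2 (plateau) with `η/g₄`, `δ/2`
  obtain ⟨r₀, hr₀, hP⟩ := hP σ hσ hσa' T ρ θ u hsol Φ τ hτ hτT a hac hapos hkl χ hχc hχ0 Ξ hΞc hΞ0 hΞC (η / g₄)
    (δ / 2) (div_pos hη hg₄) (half_pos hδ)
  -- S3 (realised floor) with `η/2`, `δ/2`
  obtain ⟨A₁, hA₁, hR⟩ := hR σ hσ hσb' T ρ θ u hsol Φ τ hτ hτT a hac hapos hkl χ hχc hχ0 Ξ hΞc hΞ0 hΞC (η / 2)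
    (δ / 2) (half_pos hη) (half_pos hδ)
  refine ⟨r₀, hr₀, ?_⟩
  intro r hr hrlt
  obtain ⟨Na, hP⟩ := hP r hr hrlt
  obtain ⟨Nb, hR⟩ := hR A₁ hA₁ le_rfl
  refine ⟨max Na Nb, ?_⟩
  intro N hN
  have h1 := hP N ((le_max_left _ _).trans hN)
  have h2 := hR N ((le_max_right _ _).trans hN)
  intro ε G γ bx Θ B pv Kc
  -- name the two auxiliary functionals exactly as the stubs do
  set ΘM := fun (uu : EuclideanSpace ℝ (Fin 3)) (th : ℝ) => ∫ v : EuclideanSpace ℝ (Fin 3), ∫ w : EuclideanSpace ℝ (Fin 3),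
    Θ Ξ v w * Literature.Analysis.FluidPDE.localMaxwellian 1 th uu v * Literature.Analysis.FluidPDE.localMaxwellian 1 th uu w
    with hΘM
  set Pr : ℝ := ∫ s in Set.Icc (0 : ℝ) τ, ∫ x : UnitAddTorus (Fin 3), χ (s, x) * (ρ s x) ^ 2 * ΘM (u s x) (θ s x) with hPr
  have e1 : Literature.MathematicalPhysics.KineticTheory.localGibbsLaw σ a₀ u₀ θ₀ N (Φ N)
      {z | 2 * Pr + η / g₄ < ∫ s in Set.Icc (0 : ℝ) τ, ∫ x : UnitAddTorus (Fin 3), χ (s, x) * B Ξ z s x} ≤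
      ENNReal.ofReal (δ / 2) := h1
  have e2 : Literature.MathematicalPhysics.KineticTheory.localGibbsLaw σ a₀ u₀ θ₀ N (Φ N)
      {z | lineSR ε (windowLen A₁ N) τ (γ z) (fun u' x y v w => χ (u', x) * Ξ (ε⁻¹ • G.sepVec x y, v, w)) <
        g₄ * σ ^ 3 * Pr - η / 2} ≤
      ENNReal.ofReal (δ / 2) := h2
  -- facts along good trajectories
  have hε : 0 < ε := hsDiameter_pos hσ N
  have hεlt : ε < 2⁻¹ := (hsDiameter_le hσ.le N).trans_lt hσ2
  have hΔ : 0 < windowLen A₁ N := by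
    rw [← windowLenB_one_third]
    exact windowLenB_pos hA₁ _ N
  have hs3 : σ ^ 3 ≤ 1 := by
    have : σ ≤ 1 := by linarith
    exact pow_le_one₀ hσ.le this
  have hF0 : ∀ (u' : ℝ) (x y : T3) (v w : V3), 0 ≤ χ (u', x) * Ξ (ε⁻¹ • G.sepVec x y, v, w) :=
    fun u' x y v w => mul_nonneg (hχ0 _) (hΞ0 _)
  have hgood : Literature.MathematicalPhysics.KineticTheory.localGibbsLaw σ a₀ u₀ θ₀ N (Φ N) (Φ N).goodᶜ = 0 := by
    rw [Literature.MathematicalPhysics.KineticTheory.localGibbsLaw, particleLaw_eq]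
    exact withDensity_absolutelyContinuous _ _ (Φ N).measure_compl_good
  have hsub : {z | Kc (fun z s i j => χ (s, (γ z s i).1) *
        Ξ (ε⁻¹ • G.sepVec (γ z s i).1 (γ z s j).1, (pv z s i j).1, (pv z s i j).2)) z <
        g₄ / 2 * σ ^ 3 * (∫ s in Set.Icc (0 : ℝ) τ, ∫ x : UnitAddTorus (Fin 3), χ (s, x) * B Ξ z s x) - η} ⊆
      {z | 2 * Pr + η / g₄ < ∫ s in Set.Icc (0 : ℝ) τ, ∫ x : UnitAddTorus (Fin 3), χ (s, x) * B Ξ z s x} ∪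
      {z | lineSR ε (windowLen A₁ N) τ (γ z) (fun u' x y v w => χ (u', x) * Ξ (ε⁻¹ • G.sepVec x y, v, w)) <
        g₄ * σ ^ 3 * Pr - η / 2} ∪
      (Φ N).goodᶜ := by
    intro z hz
    by_contra hcon
    have hca : ¬ (2 * Pr + η / g₄ < ∫ s in Set.Icc (0 : ℝ) τ, ∫ x : UnitAddTorus (Fin 3), χ (s, x) * B Ξ z s x) :=
      fun h => hcon (Or.inl (Or.inl h))
    have hcb : ¬ (lineSR ε (windowLen A₁ N) τ (γ z) (fun u' x y v w => χ (u', x) * Ξ (ε⁻¹ • G.sepVec x y, v, w)) <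
        g₄ * σ ^ 3 * Pr - η / 2) :=
      fun h => hcon (Or.inl (Or.inr h))
    have hzg : z ∈ (Φ N).good := by
      by_contra h
      exact hcon (Or.inr h)
    have htraj : IsHardSphereTrajectory G ε (N + 1) (γ z) := (Φ N).isTrajectory z hzg
    -- sure transfer: K ≥ S_R
    have hKR := lineSR_le_collisionFunctional htraj hε hεlt hΔ hτ.le
      (fun u' x y v w => χ (u', x) * Ξ (ε⁻¹ • G.sepVec x y, v, w)) hF0
    have hz' : Kc (fun z s i j => χ (s, (γ z s i).1) *
        Ξ (ε⁻¹ • G.sepVec (γ z s i).1 (γ z s j).1, (pv z s i j).1, (pv z s i j).2)) z <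
        g₄ / 2 * σ ^ 3 * (∫ s in Set.Icc (0 : ℝ) τ, ∫ x : UnitAddTorus (Fin 3), χ (s, x) * B Ξ z s x) - η := hz
    exact anchored_deficit_arith hη hg₄ (by positivity) hs3 hz' hKR hca hcb
  calc Literature.MathematicalPhysics.KineticTheory.localGibbsLaw σ a₀ u₀ θ₀ N (Φ N) _
      ≤ Literature.MathematicalPhysics.KineticTheory.localGibbsLaw σ a₀ u₀ θ₀ N (Φ N) (_ ∪ _ ∪ (Φ N).goodᶜ) :=
        measure_mono hsub
    _ ≤ Literature.MathematicalPhysics.KineticTheory.localGibbsLaw σ a₀ u₀ θ₀ N (Φ N) _ +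
          Literature.MathematicalPhysics.KineticTheory.localGibbsLaw σ a₀ u₀ θ₀ N (Φ N) _ +
          Literature.MathematicalPhysics.KineticTheory.localGibbsLaw σ a₀ u₀ θ₀ N (Φ N) (Φ N).goodᶜ :=
        (measure_union_le _ _).trans (add_le_add (measure_union_le _ _) le_rfl)
    _ ≤ ENNReal.ofReal (δ / 2) + ENNReal.ofReal (δ / 2) + 0 := add_le_add (add_le_add e1 e2) hgood.le
    _ = ENNReal.ofReal δ := by
        rw [add_zero, ← ENNReal.ofReal_add (half_pos hδ).le (half_pos hδ).le, add_halves]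

/-- **The line's composition for the anchored restatement**: S1 → S2 → S3 → `RateFloorAnchored`. -/
theorem RateFloorAnchored_of :
    AnchorFromLLN → AnchoredPlateau → AnchoredRealisedFloor → RateFloorAnchored :=
  fun h1 h2 h3 => rateFloorAnchored_of_entropic h1 (rateFloorEntropicAnchor_of h2 h3)

/-- The same, fed with the stubs (so that `lean check` reports the sorries exactly at S1–S3). -/
theorem rateFloorAnchored_skeleton : RateFloorAnchored :=
  RateFloorAnchored_of stub_anchorFromLLN stub_anchoredPlateau stub_anchoredRealisedFloor

end Summit.AtomisticToContinuum.HydrodynamicLimit.Cruxes.RateFloor.AnchoredWindowTransport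

end
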